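import Literature.MathematicalPhysics.QuantumFieldTheory.Balaban1983to89.Node00.Record12BgRowGaugeAxial

/-!
# NODE 00 — ROW P11 (ranged), the located cube geometry `hcubeΩ`: every `O(1)LM`-cube of record meeting a domain `X ⊂ Λ_j(s)` lies in `Λ_j(s) ⊂ Ω_j(s)` —
# from the COMPATIBILITY OF THE PARTITIONS («compatible with all other partitions», [III] p. 257): `L ∣ R_j` (nested grids) and `L^jMR_j ∣ 2L^{m+K}` (no wrapping)

Cell `pub-ymgap`, seat `pub-ymgap-node00-def-P11` (R218 ∕ OPS-NOTE-16); successor of the seat's FILE 4 `Node00/Record12BgRowGaugeAxial` (residue (R3) there).  [III] =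
[Balaban1988Convergent]; [I] = [Balaban1987RG1].

HONEST FRAMING.  Index arithmetic on the universal cover + pv26's non-wrapping embedding (`T4AxialGaugeSmallField.castSite_injOn_box`, cited): the geometric hypothesis
`hcubeΩ` of FILE 4 (§5∕§6) is DISCHARGED from two DISPLAYED ARITHMETIC side conditions on the record's partitions — (C1) `R_j = L·t` for some `t ≥ 1` (the `L^{j+1}M`-grid of
[I] (1.12)'s cubes REFINES the `L^jMR_j`-grid of [III]'s `𝐃_j`; print: `R_j = L^r`, (2.5)) and (C2) `L^j·M·R_j ∣ 2L^{m+K}` (the `𝐃_j`-partition is a partition of the torus; print: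
«compatible with all other partitions», p. 257) — the «compatible partitions» clause located by dag-n11-a (CUBESIDE reading) and def-R (ℓ1); r11's `Chain21` types only the
inclusions `Λ_j ⊆ Ω_j`, `Ω_{j+1} ⊆ Λ_j`, which is all this file uses of admissibility.  Nothing of Bałaban asserted; counts unmoved; not continuum ∕ OS ∕ mass gap ∕ Clay.
Theorems only; no `def`, no `instance`, no `sorry`.

WHAT IS PROVED.  §1 cover arithmetic: `box_subset_box_div` (an `s`-box of index `a` lies in the `s·t`-box of index `a ∕ t`), `box_index_unique`; §2 torus:
`cubeEnl_subset_cubeEnl_div`, `cubeIndices_bounds`, `box_lt_of_dvd`, ★ `cubeEnl_subset_of_meets_unionsOfCubes` — under `S = s·t` and `S ∣ sitesPerDir 0`, an `s`-cube of the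
grid meeting a member of `unionsOfCubes P S` lies INSIDE it; §2b ★ `exists_RkOfRecord_eq_mul` — (C1) holds in the window: `L ≥ 2`, `r ≥ 1`, `log g_j⁻² > 1` ⇒ `R_j = L·t`, `t ≥ 1`
((2.5): the least exponent is positive); §3 at def-R's objects: ★ `hcubeΩ_of_compatible` — FILE 4's `hcubeΩ` for a (2.18) index `s` from (C1)–(C2) at the scales `1 ≤ j ≤ k`
(`Chain21.memΛ`, `Chain21.Λ_subset`), and ★★ `bgProvisoΛ_UbgMSOfRecord_of_thm1Scaled_compatible` — FILE 4's §6 with `hcubeΩ` replaced by (C1)–(C2).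
v1.1 (append-only; v1.0 declarations byte-identical): §4 the same chain with the chart-reachability letters stated through the CLASS BOUNDS `B₃·cR·ε_n(g_n)` — the weakest
form the axial mechanism uses (FILE 4 stated them through `α₀(g_n)`, which at `C₀ = 1`, `γ = ½`, `j = 1` is not met): `hloc_of_thm1Scaled_axial'`, `h238_of_thm1Scaled_axial'`,
`bgProvisoΛ_UbgMSOfRecord_of_thm1Scaled_axial'`, ★★ `bgProvisoΛ_UbgMSOfRecord_of_thm1Scaled_compatible'` (node00-def-K0a's `A0OfThm1` re-pin meets these at every scale).
v1.2 (append-only): §5 ★ `bgRowAt_of_classBounds` — the row's body AT ONE SEQUENCE from per-scale CLASS BOUNDS on def-R's background (the interface both named facts plug into) —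
and ★★★ `bgRowAt_of_thm1ScaledSep` — the FAITHFUL chain: the body at every SEPARATED sequence (`Sect2.SeqSeparated ν.M₁ s`, FILE 2 v1.1) with comparable thresholds, from
`VariationalThm1ScaledSep`; the supplier of a separation-guarded token (located: r11's (2.18) index carries no separation, [III] p. 256 ∕ [6] (1.3)–(1.6)).
-/

noncomputable section

open MeasureTheory
open scoped Matrix.Norms.L2Operator

namespace Literature.MathematicalPhysics.QuantumFieldTheory.Balaban1983to89.Node00

open T4Continuum B14.Eq218Concrete B15DeterminingSets B12RegularSpaces111 B14RegularSpaces234 B14Radii T4AxialGaugeSmallField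

/-! ## §1  Cover arithmetic: nested grids -/

section Cover

variable {d : ℕ}

/-- **NESTED GRIDS ON THE COVER**: for `S = s·t` (`t ≥ 1`) and an index `a ≥ 0`, the `s`-box `[s·a, s·a + s − 1]` lies in the `S`-box of index `a ∕ t` (coordinatewise
integer division). [cite: Balaban1988Convergent, p.257 («compatible with all other partitions»; bookkeeping)] -/
theorem box_subset_box_div {s t : ℕ} (ht : 0 < t) {a : Fin d → ℤ} {z : Fin d → ℤ}
    (hz : ∀ i, (s : ℤ) * a i ≤ z i ∧ z i ≤ (s : ℤ) * a i + ((s : ℤ) - 1)) :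
    ∀ i, ((s * t : ℕ) : ℤ) * (a i / t) ≤ z i ∧ z i ≤ ((s * t : ℕ) : ℤ) * (a i / t) + (((s * t : ℕ) : ℤ) - 1) := by
  intro i
  have ht' : (0 : ℤ) < t := by exact_mod_cast ht
  have hs : (0 : ℤ) ≤ s := Nat.cast_nonneg _
  have h1 : (t : ℤ) * (a i / t) ≤ a i := Int.mul_ediv_self_le (ne_of_gt ht')
  have h2 : a i < (t : ℤ) * (a i / t) + t := Int.lt_mul_ediv_self_add ht'
  obtain ⟨hl, hu⟩ := hz i
  push_cast
  constructor <;> nlinarith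

/-- Two `S`-boxes of the grid containing a common point have the same index. [cite: Balaban1988Convergent, p.257 (bookkeeping)] -/
theorem box_index_unique {S : ℕ} (hS : 0 < S) {c c' z : ℤ} (h : (S : ℤ) * c ≤ z ∧ z ≤ (S : ℤ) * c + ((S : ℤ) - 1))
    (h' : (S : ℤ) * c' ≤ z ∧ z ≤ (S : ℤ) * c' + ((S : ℤ) - 1)) : c = c' := by
  have hS' : (0 : ℤ) < S := by exact_mod_cast hS
  have h1 : c < c' + 1 := by
    by_contra hcc
    have hcc' := not_lt.mp hcc
    nlinarith [h.1, h'.2]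
  have h2 : c' < c + 1 := by
    by_contra hcc
    have hcc' := not_lt.mp hcc
    nlinarith [h'.1, h.2]
  omega

end Cover

/-! ## §2  On the torus: an `s`-cube of the grid meeting a union of `S`-cubes lies inside it (`s ∣ S ∣ sitesPerDir`) -/

section Torus

variable {P : Params}

/-- The torus form of `box_subset_box_div`: `cubeEnl P s a 0 ⊆ cubeEnl P (s·t) (a ∕ t) 0`. [cite: Balaban1988Convergent, p.257 (bookkeeping)] -/
theorem cubeEnl_subset_cubeEnl_div {s t : ℕ} (ht : 0 < t) (a : Fin P.d → ℤ) :
    cubeEnl P s a 0 ⊆ cubeEnl P (s * t) (fun i => a i / t) 0 := by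
  rintro x ⟨z, hz, rfl⟩
  refine ⟨z, fun i => ?_, rfl⟩
  have hz' : ∀ i, (s : ℤ) * a i ≤ z i ∧ z i ≤ (s : ℤ) * a i + ((s : ℤ) - 1) := fun i => by
    have := hz i; simp only [Nat.cast_zero, zero_mul, sub_zero, add_zero] at this
    exact ⟨this.1, by linarith [this.2]⟩
  have h := box_subset_box_div ht hz' i
  simp only [Nat.cast_zero, zero_mul, sub_zero, add_zero]
  exact ⟨h.1, by linarith [h.2]⟩

/-- An index of the `s`-grid has nonnegative coordinates below `⌈sitesPerDir ∕ s⌉`. [cite: Balaban1988Convergent, (2.17) p.257 (bookkeeping)] -/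
theorem cubeIndices_bounds {s : ℕ} {a : Fin P.d → ℤ} (ha : a ∈ cubeIndices P s) (i : Fin P.d) :
    0 ≤ a i ∧ a i < (((P.sitesPerDir 0 + s - 1) / s : ℕ) : ℤ) := by
  simp only [cubeIndices, Fintype.mem_piFinset, Finset.mem_image, Finset.mem_range] at ha
  obtain ⟨n, hn, hna⟩ := ha i
  rw [← hna]
  exact ⟨by exact_mod_cast Nat.zero_le n, by exact_mod_cast hn⟩

/-- If `s ∣ N` then the box of every grid index lies in `[0, N − 1]^d` (the grid is a partition of the torus, no cube wraps). [cite: Balaban1988Convergent, (2.17) p.257 (bookkeeping)] -/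
theorem box_lt_of_dvd {s : ℕ} (hs : 0 < s) (hsN : s ∣ P.sitesPerDir 0) {a : Fin P.d → ℤ} (ha : a ∈ cubeIndices P s) {z : Fin P.d → ℤ}
    (hz : ∀ i, (s : ℤ) * a i - ((0 * s : ℕ) : ℤ) ≤ z i ∧ z i ≤ (s : ℤ) * a i + s - 1 + ((0 * s : ℕ) : ℤ)) (i : Fin P.d) :
    0 ≤ z i ∧ z i ≤ ((P.sitesPerDir 0 : ℕ) : ℤ) - 1 := by
  obtain ⟨q, hq⟩ := hsN
  have hb := cubeIndices_bounds ha i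
  have hceil : (P.sitesPerDir 0 + s - 1) / s = q := by
    rw [hq, Nat.add_sub_assoc hs, Nat.mul_comm]
    rw [Nat.add_comm, Nat.add_mul_div_right _ _ hs, Nat.div_eq_of_lt (Nat.sub_lt hs Nat.one_pos), Nat.zero_add]
  rw [hceil] at hb
  have hzi := hz i
  simp only [zero_mul, Nat.cast_zero, sub_zero, add_zero] at hzi
  have hs' : (0 : ℤ) ≤ s := Nat.cast_nonneg _
  have hN : ((P.sitesPerDir 0 : ℕ) : ℤ) = (s : ℤ) * q := by rw [hq]; push_cast; ring
  refine ⟨by nlinarith [hzi.1, hb.1], ?_⟩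
  have : a i + 1 ≤ (q : ℤ) := by linarith [hb.2]
  nlinarith [hzi.2, this]

/-- **AN `s`-CUBE OF THE GRID MEETING A UNION OF `S`-CUBES LIES INSIDE IT** (`S = s·t`, `t ≥ 1`, `S ∣ sitesPerDir 0`): the member `S`-cube it meets is the `S`-cube containing it
(nested grids + uniqueness of the grid index of a cover point; the cubes do not wrap since the grids divide the torus). [cite: Balaban1988Convergent, p.257 («compatible with all other partitions»)] -/
theorem cubeEnl_subset_of_meets_unionsOfCubes {s t : ℕ} (hs : 0 < s) (ht : 0 < t) (hSN : s * t ∣ P.sitesPerDir 0) {Λ : Set (Site P 0)}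
    (hΛ : Λ ∈ unionsOfCubes P (s * t)) {a : Fin P.d → ℤ} (ha : a ∈ cubeIndices P s) (hne : (cubeEnl P s a 0 ∩ Λ).Nonempty) :
    cubeEnl P s a 0 ⊆ Λ := by
  obtain ⟨A, hA, rfl⟩ := hΛ
  obtain ⟨x, hx, hxΛ⟩ := hne
  have hsN : s ∣ P.sitesPerDir 0 := dvd_trans (Dvd.intro t rfl) hSN
  have hS : 0 < s * t := Nat.mul_pos hs ht
  -- `x = cover z` with `z` in the `s`-box of `a`, hence in the `S`-box of `a / t`
  obtain ⟨z, hz, rfl⟩ := hx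
  have hzS : B15Eq112TorusCover.cover P z ∈ cubeEnl P (s * t) (fun i => a i / t) 0 := cubeEnl_subset_cubeEnl_div ht a ⟨z, hz, rfl⟩
  -- `x` lies in a member cube of index `a'' ∈ A`
  simp only [Set.mem_iUnion] at hxΛ
  obtain ⟨a'', ha'', hxa''⟩ := hxΛ
  obtain ⟨z'', hz'', hzz''⟩ := hxa''
  -- both `z` and `z''` lie in `[0, N − 1]^d`; equal projections ⇒ equal points
  have hN : ∀ κ : Fin P.d, (((P.sitesPerDir 0 : ℕ) : ℤ) - 1) - 0 < P.sitesPerDir 0 := fun κ => by omega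
  have hzb : ∀ i, 0 ≤ z i ∧ z i ≤ ((P.sitesPerDir 0 : ℕ) : ℤ) - 1 := box_lt_of_dvd hs hsN ha hz
  have hz''b : ∀ i, 0 ≤ z'' i ∧ z'' i ≤ ((P.sitesPerDir 0 : ℕ) : ℤ) - 1 := box_lt_of_dvd hS hSN (hA ha'') hz''
  have hzeq : z = z'' :=
    castSite_injOn_box (j := 0) (lo := fun _ => 0) (hi := fun _ => ((P.sitesPerDir 0 : ℕ) : ℤ) - 1) hN
      (fun i => (hzb i).1) (fun i => (hzb i).2) (fun i => (hz''b i).1) (fun i => (hz''b i).2) hzz''.symm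
  rw [← hzeq] at hz''
  -- the `S`-box of index `a / t` containing `z`: its representative `w` is `z` itself
  obtain ⟨w, hw, hwz⟩ := hzS
  have hwb : ∀ i, 0 ≤ w i ∧ w i ≤ ((P.sitesPerDir 0 : ℕ) : ℤ) - 1 := by
    intro i
    have h := hw i
    have hb := cubeIndices_bounds ha i
    simp only [zero_mul, Nat.cast_zero, sub_zero, add_zero] at h
    have hat : 0 ≤ a i / t := Int.ediv_nonneg hb.1 (by exact_mod_cast ht.le)
    have hS' : (0 : ℤ) < ((s * t : ℕ) : ℤ) := by exact_mod_cast hS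
    refine ⟨by nlinarith [h.1], ?_⟩
    -- `a i / t < N / S`
    obtain ⟨q, hq⟩ := hSN
    obtain ⟨q', hq'⟩ := hsN
    have hceil : (P.sitesPerDir 0 + s - 1) / s = q' := by
      rw [hq', Nat.add_sub_assoc hs, Nat.mul_comm]
      rw [Nat.add_comm, Nat.add_mul_div_right _ _ hs, Nat.div_eq_of_lt (Nat.sub_lt hs Nat.one_pos), Nat.zero_add]
    have hb2 := hb.2
    rw [hceil] at hb2
    have hq'q : q' = t * q := by
      have : s * q' = s * (t * q) := by rw [← hq', ← Nat.mul_assoc, ← hq]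
      exact Nat.eq_of_mul_eq_mul_left hs this
    have hlt : a i / t < (q : ℤ) := by
      rw [Int.ediv_lt_iff_lt_mul (by exact_mod_cast ht)]
      calc a i < (q' : ℤ) := hb2
        _ = (q : ℤ) * t := by rw [hq'q]; push_cast; ring
    have hN' : ((P.sitesPerDir 0 : ℕ) : ℤ) = ((s * t : ℕ) : ℤ) * q := by rw [hq]; push_cast; ring
    have : a i / t + 1 ≤ (q : ℤ) := by linarith
    nlinarith [h.2, this]
  have hweq : z = w :=
    castSite_injOn_box (j := 0) (lo := fun _ => 0) (hi := fun _ => ((P.sitesPerDir 0 : ℕ) : ℤ) - 1) hN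
      (fun i => (hzb i).1) (fun i => (hzb i).2) (fun i => (hwb i).1) (fun i => (hwb i).2) hwz.symm
  rw [← hweq] at hw
  have hidx : (fun i => a i / t) = a'' := by
    funext i
    have h1 := hw i
    have h2 := hz'' i
    simp only [zero_mul, Nat.cast_zero, sub_zero, add_zero] at h1 h2
    exact box_index_unique hS ⟨h1.1, by linarith [h1.2]⟩ ⟨h2.1, by linarith [h2.2]⟩
  -- conclude
  intro y hy
  have hy' := cubeEnl_subset_cubeEnl_div ht a hy
  rw [hidx] at hy'
  exact Set.mem_iUnion₂.mpr ⟨a'', ha'', hy'⟩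

end Torus

/-! ## §2b  (C1) from the window: `L ∣ R_j` as soon as `log g_j⁻² > 1` and `r ≥ 1` -/

section C1

/-- **(C1) IN THE WINDOW**: for `L ≥ 2`, `r ≥ 1` and `log g⁻² > 1` (i.e. `g² < e⁻¹`), the cube factor of (2.5) is a POSITIVE power of `L`: `R_j = L·t` with `t ≥ 1` — the least `s`
with `(log g⁻²)^r ≤ L^s` is not `0`. [cite: Balaban1988Convergent, (2.5) p.255] -/
theorem exists_RkOfRecord_eq_mul {L : ℕ} (hL : 2 ≤ L) {r : ℕ} (hr : 1 ≤ r) {g : ℝ} (hg : 1 < Real.log (g ^ 2)⁻¹) :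
    ∃ t : ℕ, 0 < t ∧ RkOfRecord L r g = L * t := by
  have h := exists_pow_ge_of_two_le hL r g
  have hfind : Nat.find h ≠ 0 := by
    intro h0
    have hspec := Nat.find_spec h
    rw [h0, pow_zero, Nat.cast_one] at hspec
    exact absurd hspec (not_le.mpr (one_lt_pow₀ hg (by omega)))
  refine ⟨L ^ (Nat.find h - 1), Nat.pow_pos (by omega), ?_⟩
  rw [RkOfRecord, dif_pos h, ← pow_succ', Nat.sub_add_cancel (Nat.one_le_iff_ne_zero.mpr hfind)]

end C1

/-! ## §3  At def-R's objects: `hcubeΩ` of FILE 4 from the compatibility of the partitions -/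

section Record

variable {F : T4Family} {N : ℕ} [NeZero N]

/-- **FILE 4's `hcubeΩ` FROM (C1)–(C2)**: along a (2.18) index `s`, if at every scale `1 ≤ j ≤ k` (C1) `R_j = L·t_j` with `t_j ≥ 1` and (C2) `L^j·M·R_j ∣ 2L^{m+K}`, then every
`L^{j+1}M`-cube of record meeting a domain `X ⊆ Λ_j(s)` lies in `Ω_j(s)`: it meets `Λ_j(s) ∈ 𝐃_j` (a union of `L^jMR_j`-cubes, `Chain21.memΛ`), so it lies inside `Λ_j(s)`
(§2), and `Λ_j(s) ⊆ Ω_j(s)` (`Chain21.Λ_subset`). [cite: Balaban1988Convergent, (2.1) p.254, p.256–257; Balaban1987RG1, (1.12) p.262] -/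
theorem hcubeΩ_of_compatible (ν : Stage7Numerics) {M : ℕ} (hM : 0 < M) (g : ℕ → ℝ) (K k : ℕ) (s : SeqOfRecord F ν M g K k)
    (hC1 : ∀ j, 1 ≤ j → j ≤ k → ∃ t : ℕ, 0 < t ∧ RkOfRecord (F.P K).L ν.r (g j) = (F.P K).L * t)
    (hC2 : ∀ j, 1 ≤ j → j ≤ k → dCubeSide (F.P K).L M (RkOfRecord (F.P K).L ν.r (g j)) j ∣ (F.P K).sitesPerDir 0) :
    ∀ j, 1 ≤ j → j ≤ k → ∀ X : (Sect2.domSys (F.P K) M j).Dom, Sect2.domSites (F.P K) M j X ⊆ s.Λ j →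
      ∀ a ∈ cubeIndices (F.P K) (B14.Eq213MaximalDomains.side (F.P K).L M (j + 1)),
        (cubeEnl (F.P K) (B14.Eq213MaximalDomains.side (F.P K).L M (j + 1)) a 0 ∩ Sect2.domSites (F.P K) M j X).Nonempty →
        cubeEnl (F.P K) (B14.Eq213MaximalDomains.side (F.P K).L M (j + 1)) a 0 ⊆ s.Ω j := by
  intro j h1 hjk X hX a ha hne
  obtain ⟨t, ht, hR⟩ := hC1 j h1 hjk
  have hside : 0 < B14.Eq213MaximalDomains.side (F.P K).L M (j + 1) := by
    unfold B14.Eq213MaximalDomains.side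
    exact Nat.mul_pos (Nat.pow_pos (F.P K).L_pos) hM
  have hS : B14.Eq213MaximalDomains.side (F.P K).L M (j + 1) * t = dCubeSide (F.P K).L M (RkOfRecord (F.P K).L ν.r (g j)) j := by
    unfold B14.Eq213MaximalDomains.side dCubeSide
    rw [hR, pow_succ]
    ring
  have hΛ : s.Λ j ∈ unionsOfCubes (F.P K) (B14.Eq213MaximalDomains.side (F.P K).L M (j + 1) * t) := by
    rw [hS]; exact s.chain.memΛ j h1 hjk
  have hSN : B14.Eq213MaximalDomains.side (F.P K).L M (j + 1) * t ∣ (F.P K).sitesPerDir 0 := by rw [hS]; exact hC2 j h1 hjk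
  have hneΛ : (cubeEnl (F.P K) (B14.Eq213MaximalDomains.side (F.P K).L M (j + 1)) a 0 ∩ s.Λ j).Nonempty :=
    hne.mono (Set.inter_subset_inter_right _ hX)
  exact (cubeEnl_subset_of_meets_unionsOfCubes hside ht hSN hΛ ha hneΛ).trans (s.chain.Λ_subset j h1 hjk)


/-- **★★ THE RANGED ROW `BgProvisoΛ` AT DEF-R'S OBJECTS — FILE 4's §6 with the cube geometry DISCHARGED by the compatibility of the partitions**: from the named fact
`VariationalThm1Scaled B₃ a₀ a₁`, the numerics (FILE 2 + FILE 4), the arithmetic side conditions (C1) `R_j = L·t_j`, (C2) `L^jMR_j ∣ 2L^{m+K}` at the scales `1 ≤ j ≤ k` along the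
setting's history, no wrapping of the cubes of record, and the two DERIVATIVE members (1.12)(c)∕(2.38)(c) for the axial potentials — nothing else displayed.
[cite: Balaban1988Convergent, (2.27)–(2.28) p.259, (2.34)–(2.41) p.261, p.256–257; Balaban1985Variational, Thm 1 (8)–(10) p.279; Balaban1987RG1, (1.11)–(1.16) p.262] -/
theorem bgProvisoΛ_UbgMSOfRecord_of_thm1Scaled_compatible {B₃ a₀ a₁ : ℝ} (h15 : VariationalThm1Scaled F N B₃ a₀ a₁)
    (S : Sect2.Setting (MatA N) (SU N)) (hι : S.ι = ιSU N) (h𝓜 : S.𝓜 = B12RegularSpaces111SpecialUnitary.suModel N) (hS : S.Laws) (hpos : S.Pos)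
    (ν : Stage7Numerics) {M : ℕ} (hM : 0 < M) (K k : ℕ) (cR : ℝ) (hB₃ : 0 ≤ B₃)
    (hnum : ∀ n, n ≤ k → 0 < cR * epsOfRecord ν S.flow.g n ∧ cR * epsOfRecord ν S.flow.g n ≤ a₁ ∧ B₃ * (cR * epsOfRecord ν S.flow.g n) ≤ ν.εreg)
    (ha₀ : ν.εreg ≤ a₀)
    (hα : ∀ n, 1 ≤ n → n ≤ k → 0 < S.lf.alpha0 (S.flow.g n) ∧ 0 < S.lf.alpha1 (S.flow.g n))
    (hBα : ∀ n, 1 ≤ n → n ≤ k → B₃ * (cR * epsOfRecord ν S.flow.g n) ≤ (1 - S.βc) * S.lf.alpha0 (S.flow.g n))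
    (hsN : ∀ n, 1 ≤ n → n ≤ k + 1 → ((B14.Eq213MaximalDomains.side (F.P K).L M n : ℕ) : ℤ) < (F.P K).sitesPerDir 0)
    (hcB : 2 * (((F.P K).d - 1 : ℕ) : ℝ) * ((F.P K).L * M) < S.cB) (hBCM : 2 * (((F.P K).d - 1 : ℕ) : ℝ) * M < S.B * S.C * S.Mr)
    (hsmallI : ∀ j, 1 ≤ j → j ≤ k → (((F.P K).d - 1 : ℕ) : ℝ) * ((F.P K).L * M) * (F.P K).eta j * S.lf.alpha0 (S.flow.g j) ≤ 1 / 2)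
    (hsmallMS : ∀ n, 1 ≤ n → n ≤ k → (((F.P K).d - 1 : ℕ) : ℝ) * M * (F.P K).eta n * S.lf.alpha0 (S.flow.g n) ≤ 1 / 2)
    (hC1 : ∀ j, 1 ≤ j → j ≤ k → ∃ t : ℕ, 0 < t ∧ RkOfRecord (F.P K).L ν.r (S.flow.g j) = (F.P K).L * t)
    (hC2 : ∀ j, 1 ≤ j → j ≤ k → dCubeSide (F.P K).L M (RkOfRecord (F.P K).L ν.r (S.flow.g j)) j ∣ (F.P K).sitesPerDir 0)
    (h3I : ∀ (s : SeqOfRecord F ν M S.flow.g K k) (W : MSField (F.P K) (SU N)), W ∈ regSuppOfRecord F N ν M S.flow.g K k cR s →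
      W ∈ solvableDom (avOfRecord F N K) (regMSOfRecord F N ν K k s.Ω) (genSet s.Ω k) →
      ∀ j, 1 ≤ j → j ≤ k → ∀ X : (Sect2.domSys (F.P K) M j).Dom, Sect2.domSites (F.P K) M j X ⊆ s.Λ j →
      ∀ a ∈ cubeIndices (F.P K) (B14.Eq213MaximalDomains.side (F.P K).L M (j + 1)),
        (cubeEnl (F.P K) (B14.Eq213MaximalDomains.side (F.P K).L M (j + 1)) a 0 ∩ Sect2.domSites (F.P K) M j X).Nonempty →
        ∀ q ∈ (Sect2.regionOfSet (F.P K) (cubeEnl (F.P K) (B14.Eq213MaximalDomains.side (F.P K).L M (j + 1)) a 0 ∩ Sect2.domSites (F.P K) M j X)).dpairs,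
          ‖grad ((F.P K).eta j) q.2.1 (fun y => axialPotential (UbgMSOfRecord F N ν M S.flow.g K k s W)
            (boxLo (B14.Eq213MaximalDomains.side (F.P K).L M (j + 1)) a) (boxHi (B14.Eq213MaximalDomains.side (F.P K).L M (j + 1)) a) ((F.P K).eta j)
            ⟨y, q.2.2⟩) q.1‖ < S.cB * S.lf.alpha0 (S.flow.g j))
    (h3MS : ∀ (s : SeqOfRecord F ν M S.flow.g K k) (W : MSField (F.P K) (SU N)), W ∈ regSuppOfRecord F N ν M S.flow.g K k cR s →
      W ∈ solvableDom (avOfRecord F N K) (regMSOfRecord F N ν K k s.Ω) (genSet s.Ω k) →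
      ∀ j, 1 ≤ j → j ≤ k → ∀ X : (Sect2.domSys (F.P K) M j).Dom, ∀ n, 1 ≤ n → n ≤ j →
      ∀ a ∈ cubeIndices (F.P K) (B14.Eq213MaximalDomains.side (F.P K).L M n),
        (cubeEnl (F.P K) (B14.Eq213MaximalDomains.side (F.P K).L M n) a 0 ∩ Sect2.domSites (F.P K) M j X).Nonempty →
        cubeEnl (F.P K) (B14.Eq213MaximalDomains.side (F.P K).L M n) a 0 ⊆ s.Ω n →
        ∀ q ∈ (Sect2.regionOfSet (F.P K) (cubeEnl (F.P K) (B14.Eq213MaximalDomains.side (F.P K).L M n) a 0 ∩ Sect2.domSites (F.P K) M j X)).dpairs,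
          (((F.P K).L : ℝ) ^ n * (F.P K).eta j) ^ 2 * ‖grad ((F.P K).eta j) q.2.1 (fun y => axialPotential (UbgMSOfRecord F N ν M S.flow.g K k s W)
            (boxLo (B14.Eq213MaximalDomains.side (F.P K).L M n) a) (boxHi (B14.Eq213MaximalDomains.side (F.P K).L M n) a) ((F.P K).eta j) ⟨y, q.2.2⟩) q.1‖ <
            rad238 S.B S.C S.Mr (S.lf.alpha0 (S.flow.g n))) :
    BgProvisoΛ F N K S (Sect2.Residual.unit (F.P K) (MatA N)) M k (regSuppOfRecord F N ν M S.flow.g K k cR) (UbgMSOfRecord F N ν M S.flow.g K k) :=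
  bgProvisoΛ_UbgMSOfRecord_of_thm1Scaled_axial h15 S hι h𝓜 hS hpos ν M K k cR hB₃ hnum ha₀ hα hBα hsN hcB hBCM hsmallI hsmallMS
    (fun s j h1 hjk X hX a ha hne => hcubeΩ_of_compatible ν hM S.flow.g K k s hC1 hC2 j h1 hjk X hX a ha hne) h3I h3MS

end Record

/-! ## §4 (v1.1, append-only)  The same chain with chart reachability stated through the CLASS BOUNDS `B₃·cR·ε_n` — the weakest letters the mechanism uses -/

section V11

variable {F : T4Family} {N : ℕ} [NeZero N]

/-- **v1.1 — THE (1.12) CLAUSE `hloc`, chart reachability stated through the CLASS BOUND `B₃·cR·ε_j` (the weakest form the mechanism uses; FILE 4's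
`hloc_of_thm1Scaled_axial` reads it through `α₀(g_j)`, too strong at `j = 1` for `C₀ = 1`, `γ = ½`)**: for retained solvable `𝐖`, scale `1 ≤ j ≤ k`,
`X ⊆ Λ_j(s)` and every cube `C ∈ cubesI M j (domSites X)`, the axial gauge of def-R's `U_k(s)(𝐖)` on the `L^{j+1}M`-box of `C` gives (a) `U^u = exp iξA` and (b)
`|A| < O(1)LMB·α₀(g_j)` — from the named fact (class bound `B₃·cR·ε_j·η_j²` on `Ω_j(s)`), the located cube geometry (`hcubeΩ`: cubes meeting `X ⊂ Λ_j` lie in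
`Ω_j`; `hsN`: no wrapping), and the numerics `B₃·cR·ε_j ≤ α₀(g_j)`, `2(d−1)LM < O(1)LMB` (print's «B sufficiently large»), `(d−1)·LM·η_j·α₀(g_j) ≤ 1∕2`; (c) the
derivative member is the displayed hypothesis `h3` on the SAME axial potential ([15] Thm 1 (9)–(10)). [cite: Balaban1987RG1, (1.12) p.262; Balaban1988Convergent, (2.28) p.259, p.256; Balaban1985Variational, Thm 1 (8)–(10) p.279] -/
theorem hloc_of_thm1Scaled_axial' {B₃ a₀ a₁ : ℝ} (h15 : VariationalThm1Scaled F N B₃ a₀ a₁) (S : Sect2.Setting (MatA N) (SU N)) (hι : S.ι = ιSU N)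
    (h𝓜 : S.𝓜 = B12RegularSpaces111SpecialUnitary.suModel N) (ν : Stage7Numerics) (M : ℕ) (K k : ℕ) (cR : ℝ) (hB₃ : 0 ≤ B₃)
    (hnum : ∀ n, n ≤ k → 0 < cR * epsOfRecord ν S.flow.g n ∧ cR * epsOfRecord ν S.flow.g n ≤ a₁ ∧ B₃ * (cR * epsOfRecord ν S.flow.g n) ≤ ν.εreg)
    (ha₀ : ν.εreg ≤ a₀)
    (hBα : ∀ j, 1 ≤ j → j ≤ k → B₃ * (cR * epsOfRecord ν S.flow.g j) ≤ S.lf.alpha0 (S.flow.g j))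
    (hα : ∀ j, 1 ≤ j → j ≤ k → 0 < S.lf.alpha0 (S.flow.g j))
    (hsN : ∀ j, 1 ≤ j → j ≤ k → ((B14.Eq213MaximalDomains.side (F.P K).L M (j + 1) : ℕ) : ℤ) < (F.P K).sitesPerDir 0)
    (hcB : 2 * (((F.P K).d - 1 : ℕ) : ℝ) * ((F.P K).L * M) < S.cB)
    (hsmallb : ∀ j, 1 ≤ j → j ≤ k → (((F.P K).d - 1 : ℕ) : ℝ) * ((F.P K).L * M) * (F.P K).eta j * (B₃ * (cR * epsOfRecord ν S.flow.g j)) ≤ 1 / 2)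
    (hcubeΩ : ∀ (s : SeqOfRecord F ν M S.flow.g K k) (j : ℕ), 1 ≤ j → j ≤ k → ∀ X : (Sect2.domSys (F.P K) M j).Dom, Sect2.domSites (F.P K) M j X ⊆ s.Λ j →
      ∀ a ∈ cubeIndices (F.P K) (B14.Eq213MaximalDomains.side (F.P K).L M (j + 1)),
        (cubeEnl (F.P K) (B14.Eq213MaximalDomains.side (F.P K).L M (j + 1)) a 0 ∩ Sect2.domSites (F.P K) M j X).Nonempty →
        cubeEnl (F.P K) (B14.Eq213MaximalDomains.side (F.P K).L M (j + 1)) a 0 ⊆ s.Ω j)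
    (h3 : ∀ (s : SeqOfRecord F ν M S.flow.g K k) (W : MSField (F.P K) (SU N)), W ∈ regSuppOfRecord F N ν M S.flow.g K k cR s →
      W ∈ solvableDom (avOfRecord F N K) (regMSOfRecord F N ν K k s.Ω) (genSet s.Ω k) →
      ∀ j, 1 ≤ j → j ≤ k → ∀ X : (Sect2.domSys (F.P K) M j).Dom, Sect2.domSites (F.P K) M j X ⊆ s.Λ j →
      ∀ a ∈ cubeIndices (F.P K) (B14.Eq213MaximalDomains.side (F.P K).L M (j + 1)),
        (cubeEnl (F.P K) (B14.Eq213MaximalDomains.side (F.P K).L M (j + 1)) a 0 ∩ Sect2.domSites (F.P K) M j X).Nonempty →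
        ∀ q ∈ (Sect2.regionOfSet (F.P K) (cubeEnl (F.P K) (B14.Eq213MaximalDomains.side (F.P K).L M (j + 1)) a 0 ∩ Sect2.domSites (F.P K) M j X)).dpairs,
          ‖grad ((F.P K).eta j) q.2.1 (fun y => axialPotential (UbgMSOfRecord F N ν M S.flow.g K k s W)
            (boxLo (B14.Eq213MaximalDomains.side (F.P K).L M (j + 1)) a) (boxHi (B14.Eq213MaximalDomains.side (F.P K).L M (j + 1)) a) ((F.P K).eta j)
            ⟨y, q.2.2⟩) q.1‖ < S.cB * S.lf.alpha0 (S.flow.g j)) :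
    ∀ (s : SeqOfRecord F ν M S.flow.g K k) (W : MSField (F.P K) (SU N)), W ∈ regSuppOfRecord F N ν M S.flow.g K k cR s →
      W ∈ solvableDom (avOfRecord F N K) (regMSOfRecord F N ν K k s.Ω) (genSet s.Ω k) →
      ∀ j, 1 ≤ j → j ≤ k → ∀ X : (Sect2.domSys (F.P K) M j).Dom, Sect2.domSites (F.P K) M j X ⊆ s.Λ j →
      ∀ C ∈ Sect2.cubesI M j (Sect2.domSites (F.P K) M j X), ∃ u : Site (F.P K) 0 → (MatA N)ˣ, (∀ x, u x ∈ S.𝓜.G) ∧ ∃ A : PBond (F.P K) 0 → MatA N,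
        (∀ bd ∈ C.bonds, gaugeU u (fun b' => S.ι (UbgMSOfRecord F N ν M S.flow.g K k s W b')) bd = expI ((F.P K).eta j) (A bd)) ∧
        (∀ bd ∈ C.bonds, ‖A bd‖ < S.cB * S.lf.alpha0 (S.flow.g j)) ∧
        ∀ q ∈ C.dpairs, ‖grad ((F.P K).eta j) q.2.1 (fun y => A ⟨y, q.2.2⟩) q.1‖ < S.cB * S.lf.alpha0 (S.flow.g j) := by
  intro s W hW hsol j h1 hjk X hX C hC
  set b := B₃ * (cR * epsOfRecord ν S.flow.g j) with hb
  have hb0 : 0 ≤ b := mul_nonneg hB₃ (hnum j hjk).1.le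
  have hclass : PlaqSmallOn (B8Eq17ClassAkV1.plaqsOf (s.Ω j)) (b * (F.P K).eta j ^ 2) (UbgMSOfRecord F N ν M S.flow.g K k s W) := by
    have h := plaqSmallOn_UbgMSOfRecord_of_thm1Scaled h15 ν M S.flow.g K k cR s hnum ha₀ hW hsol j hjk
    rwa [omegaPlaqs_of_ne_zero _ (Nat.one_le_iff_ne_zero.mp h1)] at h
  -- the two numerics of §4 from the letter forms
  have hη : 0 < (F.P K).eta j := pow_pos (inv_pos.mpr (Nat.cast_pos.mpr (F.P K).L_pos)) j
  have hside := side_pred_mul_eta_le (P := F.P K) M j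
  have hd : (0 : ℝ) ≤ (((F.P K).d - 1 : ℕ) : ℝ) := Nat.cast_nonneg _
  have hbα : b ≤ S.lf.alpha0 (S.flow.g j) := hBα j h1 hjk
  have hα0 : 0 < S.lf.alpha0 (S.flow.g j) := hα j h1 hjk
  have hprod : (((F.P K).d - 1 : ℕ) : ℝ) * ((B14.Eq213MaximalDomains.side (F.P K).L M (j + 1) - 1 : ℕ) : ℝ) * (b * (F.P K).eta j ^ 2) ≤
      (((F.P K).d - 1 : ℕ) : ℝ) * ((F.P K).L * M) * (F.P K).eta j * b := by
    calc (((F.P K).d - 1 : ℕ) : ℝ) * ((B14.Eq213MaximalDomains.side (F.P K).L M (j + 1) - 1 : ℕ) : ℝ) * (b * (F.P K).eta j ^ 2)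
        = (((F.P K).d - 1 : ℕ) : ℝ) * ((((B14.Eq213MaximalDomains.side (F.P K).L M (j + 1) - 1 : ℕ) : ℝ)) * (F.P K).eta j) * (F.P K).eta j * b := by ring
      _ ≤ (((F.P K).d - 1 : ℕ) : ℝ) * ((F.P K).L * M) * (F.P K).eta j * b := by
        gcongr
  have hsmall : (((F.P K).d - 1 : ℕ) : ℝ) * ((B14.Eq213MaximalDomains.side (F.P K).L M (j + 1) - 1 : ℕ) : ℝ) * (b * (F.P K).eta j ^ 2) ≤ 1 / 2 :=
    hprod.trans (hsmallb j h1 hjk)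
  have hcB' : 2 * ((((F.P K).d - 1 : ℕ) : ℝ) * ((B14.Eq213MaximalDomains.side (F.P K).L M (j + 1) - 1 : ℕ) : ℝ) * (b * (F.P K).eta j ^ 2)) / (F.P K).eta j <
      S.cB * S.lf.alpha0 (S.flow.g j) := by
    rw [div_lt_iff₀ hη]
    have hs0 : (0 : ℝ) ≤ ((B14.Eq213MaximalDomains.side (F.P K).L M (j + 1) - 1 : ℕ) : ℝ) := Nat.cast_nonneg _
    calc 2 * ((((F.P K).d - 1 : ℕ) : ℝ) * ((B14.Eq213MaximalDomains.side (F.P K).L M (j + 1) - 1 : ℕ) : ℝ) * (b * (F.P K).eta j ^ 2))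
        = (2 * (((F.P K).d - 1 : ℕ) : ℝ) * ((((B14.Eq213MaximalDomains.side (F.P K).L M (j + 1) - 1 : ℕ) : ℝ)) * (F.P K).eta j) * b) * (F.P K).eta j := by ring
      _ ≤ (2 * (((F.P K).d - 1 : ℕ) : ℝ) * ((F.P K).L * M) * S.lf.alpha0 (S.flow.g j)) * (F.P K).eta j := by gcongr
      _ < S.cB * S.lf.alpha0 (S.flow.g j) * (F.P K).eta j := by
        have := mul_lt_mul_of_pos_right hcB hα0
        nlinarith
  simp only [hι, h𝓜]
  exact localGauge_cubesI_of_classBound (hsN j h1 hjk) (hcubeΩ s j h1 hjk X hX) hb0 hclass hsmall hcB' (h3 s W hW hsol j h1 hjk X hX) C hC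

/-- **v1.1 — THE (2.38) CLAUSE `h238`, chart reachability through the CLASS BOUNDS `B₃·cR·ε_n`** (FILE 4's `h238_of_thm1Scaled_axial` reads it through `α₀(g_n)`): for retained solvable `𝐖`, scale `1 ≤ j ≤ k`, any
domain `X` (the (2.41) range plays no role here), r11's `CondII238` for `ι ∘ U_k(s)(𝐖)` on the multi-scale frame of record — clauses (a)(b) by the axial gauge on each
layer cube (class bounds `B₃·cR·ε_n·η_n²` on `Ω_n(s)` from the named fact; numerics `2(d−1)M < BCM`, `(d−1)·M·η_n·α₀(g_n) ≤ 1∕2`; no wrapping), clause (c) the displayed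
hypothesis `h3` for the same axial potentials ([15] Thm 1 (9)–(10)). [cite: Balaban1988Convergent, (2.38) p.261; Balaban1985Variational, Thm 1 (8)–(10) p.279] -/
theorem h238_of_thm1Scaled_axial' {B₃ a₀ a₁ : ℝ} (h15 : VariationalThm1Scaled F N B₃ a₀ a₁) (S : Sect2.Setting (MatA N) (SU N)) (hι : S.ι = ιSU N)
    (h𝓜 : S.𝓜 = B12RegularSpaces111SpecialUnitary.suModel N) (ν : Stage7Numerics) (M : ℕ) (K k : ℕ) (cR : ℝ) (hB₃ : 0 ≤ B₃)
    (hnum : ∀ n, n ≤ k → 0 < cR * epsOfRecord ν S.flow.g n ∧ cR * epsOfRecord ν S.flow.g n ≤ a₁ ∧ B₃ * (cR * epsOfRecord ν S.flow.g n) ≤ ν.εreg)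
    (ha₀ : ν.εreg ≤ a₀)
    (hBα : ∀ n, 1 ≤ n → n ≤ k → B₃ * (cR * epsOfRecord ν S.flow.g n) ≤ S.lf.alpha0 (S.flow.g n))
    (hα : ∀ n, 1 ≤ n → n ≤ k → 0 < S.lf.alpha0 (S.flow.g n))
    (hsN : ∀ n, 1 ≤ n → n ≤ k → ((B14.Eq213MaximalDomains.side (F.P K).L M n : ℕ) : ℤ) < (F.P K).sitesPerDir 0)
    (hBCM : 2 * (((F.P K).d - 1 : ℕ) : ℝ) * M < S.B * S.C * S.Mr)
    (hsmallb : ∀ n, 1 ≤ n → n ≤ k → (((F.P K).d - 1 : ℕ) : ℝ) * M * (F.P K).eta n * (B₃ * (cR * epsOfRecord ν S.flow.g n)) ≤ 1 / 2)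
    (h3 : ∀ (s : SeqOfRecord F ν M S.flow.g K k) (W : MSField (F.P K) (SU N)), W ∈ regSuppOfRecord F N ν M S.flow.g K k cR s →
      W ∈ solvableDom (avOfRecord F N K) (regMSOfRecord F N ν K k s.Ω) (genSet s.Ω k) →
      ∀ j, 1 ≤ j → j ≤ k → ∀ X : (Sect2.domSys (F.P K) M j).Dom, ∀ n, 1 ≤ n → n ≤ j →
      ∀ a ∈ cubeIndices (F.P K) (B14.Eq213MaximalDomains.side (F.P K).L M n),
        (cubeEnl (F.P K) (B14.Eq213MaximalDomains.side (F.P K).L M n) a 0 ∩ Sect2.domSites (F.P K) M j X).Nonempty →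
        cubeEnl (F.P K) (B14.Eq213MaximalDomains.side (F.P K).L M n) a 0 ⊆ s.Ω n →
        ∀ q ∈ (Sect2.regionOfSet (F.P K) (cubeEnl (F.P K) (B14.Eq213MaximalDomains.side (F.P K).L M n) a 0 ∩ Sect2.domSites (F.P K) M j X)).dpairs,
          (((F.P K).L : ℝ) ^ n * (F.P K).eta j) ^ 2 * ‖grad ((F.P K).eta j) q.2.1 (fun y => axialPotential (UbgMSOfRecord F N ν M S.flow.g K k s W)
            (boxLo (B14.Eq213MaximalDomains.side (F.P K).L M n) a) (boxHi (B14.Eq213MaximalDomains.side (F.P K).L M n) a) ((F.P K).eta j) ⟨y, q.2.2⟩) q.1‖ <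
            rad238 S.B S.C S.Mr (S.lf.alpha0 (S.flow.g n))) :
    ∀ (s : SeqOfRecord F ν M S.flow.g K k) (W : MSField (F.P K) (SU N)), W ∈ regSuppOfRecord F N ν M S.flow.g K k cR s →
      W ∈ solvableDom (avOfRecord F N K) (regMSOfRecord F N ν K k s.Ω) (genSet s.Ω k) →
      ∀ j, 1 ≤ j → j ≤ k → ∀ X : (Sect2.domSys (F.P K) M j).Dom,
      Sect2.admB (F.P K) ν M S.flow.g s.Ω s.Λ j (Sect2.domSites (F.P K) M j X) = true →
      CondII238 S.𝓜 (Sect2.frameMS (Sect2.Residual.unit (F.P K) (MatA N)) M j (Sect2.domSites (F.P K) M j X) s.Ω)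
        (MSConsts.ofParams (F.P K) S.βc S.B S.C S.Mr j) (fun n => S.lf.alpha0 (S.flow.g n)) (fun b' => S.ι (UbgMSOfRecord F N ν M S.flow.g K k s W b')) := by
  intro s W hW hsol j h1 hjk X _
  have hclass : ∀ n, 1 ≤ n → n ≤ j →
      PlaqSmallOn (B8Eq17ClassAkV1.plaqsOf (s.Ω n)) (B₃ * (cR * epsOfRecord ν S.flow.g n) * (F.P K).eta n ^ 2) (UbgMSOfRecord F N ν M S.flow.g K k s W) := by
    intro n hn1 hnj
    have h := plaqSmallOn_UbgMSOfRecord_of_thm1Scaled h15 ν M S.flow.g K k cR s hnum ha₀ hW hsol n (hnj.trans hjk)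
    rwa [omegaPlaqs_of_ne_zero _ (Nat.one_le_iff_ne_zero.mp hn1)] at h
  have hηj : 0 < (F.P K).eta j := pow_pos (inv_pos.mpr (Nat.cast_pos.mpr (F.P K).L_pos)) j
  have hd : (0 : ℝ) ≤ (((F.P K).d - 1 : ℕ) : ℝ) := Nat.cast_nonneg _
  have key : ∀ n, 1 ≤ n → n ≤ j →
      (((F.P K).d - 1 : ℕ) : ℝ) * ((B14.Eq213MaximalDomains.side (F.P K).L M n - 1 : ℕ) : ℝ) * (B₃ * (cR * epsOfRecord ν S.flow.g n) * (F.P K).eta n ^ 2) ≤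
        (((F.P K).d - 1 : ℕ) : ℝ) * M * (F.P K).eta n * (B₃ * (cR * epsOfRecord ν S.flow.g n)) := by
    intro n hn1 hnj
    have hside := side_pred_mul_eta_le' (P := F.P K) M n
    have hηn : 0 ≤ (F.P K).eta n := (pow_pos (inv_pos.mpr (Nat.cast_pos.mpr (F.P K).L_pos)) n).le
    have hb0 : 0 ≤ B₃ * (cR * epsOfRecord ν S.flow.g n) := mul_nonneg hB₃ (hnum n (hnj.trans hjk)).1.le
    calc (((F.P K).d - 1 : ℕ) : ℝ) * ((B14.Eq213MaximalDomains.side (F.P K).L M n - 1 : ℕ) : ℝ) * (B₃ * (cR * epsOfRecord ν S.flow.g n) * (F.P K).eta n ^ 2)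
        = (((F.P K).d - 1 : ℕ) : ℝ) * (((B14.Eq213MaximalDomains.side (F.P K).L M n - 1 : ℕ) : ℝ) * (F.P K).eta n) * (F.P K).eta n *
            (B₃ * (cR * epsOfRecord ν S.flow.g n)) := by ring
      _ ≤ (((F.P K).d - 1 : ℕ) : ℝ) * M * (F.P K).eta n * (B₃ * (cR * epsOfRecord ν S.flow.g n)) := by gcongr
  simp only [hι, h𝓜]
  refine condII238_cubesMS_of_classBounds (fun n hn1 hnj => hsN n hn1 (hnj.trans hjk))
    (fun n _ hnj => mul_nonneg hB₃ (hnum n (hnj.trans hjk)).1.le) hclass (fun n hn1 hnj => (key n hn1 hnj).trans (hsmallb n hn1 (hnj.trans hjk)))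
    (fun n hn1 hnj => ?_) (fun n hn1 hnj a ha hne hΩ q hq => h3 s W hW hsol j h1 hjk X n hn1 hnj a ha hne hΩ q hq)
  -- the radius inequality: `Lⁿη_j · 2(d−1)(s−1)bη_n²∕η_j = 2(d−1)·[(s−1)η_n]·(Lⁿη_n)·b ≤ 2(d−1)M·α₀(g_n) < BCM·α₀(g_n)`
  have hα0 := hα n hn1 (hnj.trans hjk)
  have hside := side_pred_mul_eta_le' (P := F.P K) M n
  have hb0 : 0 ≤ B₃ * (cR * epsOfRecord ν S.flow.g n) := mul_nonneg hB₃ (hnum n (hnj.trans hjk)).1.le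
  have hbα := hBα n hn1 (hnj.trans hjk)
  have hLη := L_pow_mul_eta (P := F.P K) n
  rw [mul_div_assoc', div_lt_iff₀ hηj]
  unfold rad238
  calc ((F.P K).L : ℝ) ^ n * (F.P K).eta j * (2 * ((((F.P K).d - 1 : ℕ) : ℝ) * ((B14.Eq213MaximalDomains.side (F.P K).L M n - 1 : ℕ) : ℝ) *
        (B₃ * (cR * epsOfRecord ν S.flow.g n) * (F.P K).eta n ^ 2)))
      = (2 * (((F.P K).d - 1 : ℕ) : ℝ) * (((B14.Eq213MaximalDomains.side (F.P K).L M n - 1 : ℕ) : ℝ) * (F.P K).eta n) *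
          (((F.P K).L : ℝ) ^ n * (F.P K).eta n) * (B₃ * (cR * epsOfRecord ν S.flow.g n))) * (F.P K).eta j := by ring
    _ ≤ (2 * (((F.P K).d - 1 : ℕ) : ℝ) * M * 1 * S.lf.alpha0 (S.flow.g n)) * (F.P K).eta j := by rw [hLη]; gcongr
    _ < S.B * S.C * S.Mr * S.lf.alpha0 (S.flow.g n) * (F.P K).eta j := by
        have := mul_lt_mul_of_pos_right hBCM hα0
        nlinarith

/-- **v1.1 — ★★ `BgProvisoΛ` AT DEF-R'S OBJECTS, chart reachability through the class bounds** (otherwise = FILE 4's `bgProvisoΛ_UbgMSOfRecord_of_thm1Scaled_axial`) —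
FILE 2's `bgProvisoΛ_UbgMSOfRecord_of_thm1Scaled` with its two gauge clauses supplied by the axial gauge up to «`|∇^ξ A| < …`» for the axial potentials (displayed:
`h3I`, `h3MS` — [15] Thm 1 (9)–(10)).  Numerics added by the gauge half: `2(d−1)LM < O(1)LMB`, `2(d−1)M < BCM` (print's «B sufficiently large»), and the chart
reachability `(d−1)·LM·η_j·α₀(g_j) ≤ 1∕2`, `(d−1)·M·η_n·α₀(g_n) ≤ 1∕2`; geometry: `hcubeΩ` (cubes of `X ⊂ Λ_j` lie in `Ω_j`), `hsN` (no wrapping).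
[cite: Balaban1988Convergent, (2.27)–(2.28) p.259, (2.34)–(2.41) p.261, p.256; Balaban1985Variational, Thm 1 (8)–(10) p.279; Balaban1987RG1, (1.11)–(1.16) p.262] -/
theorem bgProvisoΛ_UbgMSOfRecord_of_thm1Scaled_axial' {B₃ a₀ a₁ : ℝ} (h15 : VariationalThm1Scaled F N B₃ a₀ a₁)
    (S : Sect2.Setting (MatA N) (SU N)) (hι : S.ι = ιSU N) (h𝓜 : S.𝓜 = B12RegularSpaces111SpecialUnitary.suModel N) (hS : S.Laws) (hpos : S.Pos)
    (ν : Stage7Numerics) (M : ℕ) (K k : ℕ) (cR : ℝ) (hB₃ : 0 ≤ B₃)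
    (hnum : ∀ n, n ≤ k → 0 < cR * epsOfRecord ν S.flow.g n ∧ cR * epsOfRecord ν S.flow.g n ≤ a₁ ∧ B₃ * (cR * epsOfRecord ν S.flow.g n) ≤ ν.εreg)
    (ha₀ : ν.εreg ≤ a₀)
    (hα : ∀ n, 1 ≤ n → n ≤ k → 0 < S.lf.alpha0 (S.flow.g n) ∧ 0 < S.lf.alpha1 (S.flow.g n))
    (hBα : ∀ n, 1 ≤ n → n ≤ k → B₃ * (cR * epsOfRecord ν S.flow.g n) ≤ (1 - S.βc) * S.lf.alpha0 (S.flow.g n))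
    (hsN : ∀ n, 1 ≤ n → n ≤ k + 1 → ((B14.Eq213MaximalDomains.side (F.P K).L M n : ℕ) : ℤ) < (F.P K).sitesPerDir 0)
    (hcB : 2 * (((F.P K).d - 1 : ℕ) : ℝ) * ((F.P K).L * M) < S.cB) (hBCM : 2 * (((F.P K).d - 1 : ℕ) : ℝ) * M < S.B * S.C * S.Mr)
    (hsmallI : ∀ j, 1 ≤ j → j ≤ k → (((F.P K).d - 1 : ℕ) : ℝ) * ((F.P K).L * M) * (F.P K).eta j * (B₃ * (cR * epsOfRecord ν S.flow.g j)) ≤ 1 / 2)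
    (hsmallMS : ∀ n, 1 ≤ n → n ≤ k → (((F.P K).d - 1 : ℕ) : ℝ) * M * (F.P K).eta n * (B₃ * (cR * epsOfRecord ν S.flow.g n)) ≤ 1 / 2)
    (hcubeΩ : ∀ (s : SeqOfRecord F ν M S.flow.g K k) (j : ℕ), 1 ≤ j → j ≤ k → ∀ X : (Sect2.domSys (F.P K) M j).Dom, Sect2.domSites (F.P K) M j X ⊆ s.Λ j →
      ∀ a ∈ cubeIndices (F.P K) (B14.Eq213MaximalDomains.side (F.P K).L M (j + 1)),
        (cubeEnl (F.P K) (B14.Eq213MaximalDomains.side (F.P K).L M (j + 1)) a 0 ∩ Sect2.domSites (F.P K) M j X).Nonempty →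
        cubeEnl (F.P K) (B14.Eq213MaximalDomains.side (F.P K).L M (j + 1)) a 0 ⊆ s.Ω j)
    (h3I : ∀ (s : SeqOfRecord F ν M S.flow.g K k) (W : MSField (F.P K) (SU N)), W ∈ regSuppOfRecord F N ν M S.flow.g K k cR s →
      W ∈ solvableDom (avOfRecord F N K) (regMSOfRecord F N ν K k s.Ω) (genSet s.Ω k) →
      ∀ j, 1 ≤ j → j ≤ k → ∀ X : (Sect2.domSys (F.P K) M j).Dom, Sect2.domSites (F.P K) M j X ⊆ s.Λ j →
      ∀ a ∈ cubeIndices (F.P K) (B14.Eq213MaximalDomains.side (F.P K).L M (j + 1)),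
        (cubeEnl (F.P K) (B14.Eq213MaximalDomains.side (F.P K).L M (j + 1)) a 0 ∩ Sect2.domSites (F.P K) M j X).Nonempty →
        ∀ q ∈ (Sect2.regionOfSet (F.P K) (cubeEnl (F.P K) (B14.Eq213MaximalDomains.side (F.P K).L M (j + 1)) a 0 ∩ Sect2.domSites (F.P K) M j X)).dpairs,
          ‖grad ((F.P K).eta j) q.2.1 (fun y => axialPotential (UbgMSOfRecord F N ν M S.flow.g K k s W)
            (boxLo (B14.Eq213MaximalDomains.side (F.P K).L M (j + 1)) a) (boxHi (B14.Eq213MaximalDomains.side (F.P K).L M (j + 1)) a) ((F.P K).eta j)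
            ⟨y, q.2.2⟩) q.1‖ < S.cB * S.lf.alpha0 (S.flow.g j))
    (h3MS : ∀ (s : SeqOfRecord F ν M S.flow.g K k) (W : MSField (F.P K) (SU N)), W ∈ regSuppOfRecord F N ν M S.flow.g K k cR s →
      W ∈ solvableDom (avOfRecord F N K) (regMSOfRecord F N ν K k s.Ω) (genSet s.Ω k) →
      ∀ j, 1 ≤ j → j ≤ k → ∀ X : (Sect2.domSys (F.P K) M j).Dom, ∀ n, 1 ≤ n → n ≤ j →
      ∀ a ∈ cubeIndices (F.P K) (B14.Eq213MaximalDomains.side (F.P K).L M n),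
        (cubeEnl (F.P K) (B14.Eq213MaximalDomains.side (F.P K).L M n) a 0 ∩ Sect2.domSites (F.P K) M j X).Nonempty →
        cubeEnl (F.P K) (B14.Eq213MaximalDomains.side (F.P K).L M n) a 0 ⊆ s.Ω n →
        ∀ q ∈ (Sect2.regionOfSet (F.P K) (cubeEnl (F.P K) (B14.Eq213MaximalDomains.side (F.P K).L M n) a 0 ∩ Sect2.domSites (F.P K) M j X)).dpairs,
          (((F.P K).L : ℝ) ^ n * (F.P K).eta j) ^ 2 * ‖grad ((F.P K).eta j) q.2.1 (fun y => axialPotential (UbgMSOfRecord F N ν M S.flow.g K k s W)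
            (boxLo (B14.Eq213MaximalDomains.side (F.P K).L M n) a) (boxHi (B14.Eq213MaximalDomains.side (F.P K).L M n) a) ((F.P K).eta j) ⟨y, q.2.2⟩) q.1‖ <
            rad238 S.B S.C S.Mr (S.lf.alpha0 (S.flow.g n))) :
    BgProvisoΛ F N K S (Sect2.Residual.unit (F.P K) (MatA N)) M k (regSuppOfRecord F N ν M S.flow.g K k cR) (UbgMSOfRecord F N ν M S.flow.g K k) := by
  have hBα' : ∀ n, 1 ≤ n → n ≤ k → B₃ * (cR * epsOfRecord ν S.flow.g n) ≤ S.lf.alpha0 (S.flow.g n) := by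
    intro n hn1 hnk
    refine (hBα n hn1 hnk).trans ?_
    have h0 := (hα n hn1 hnk).1.le
    nlinarith [hpos.βc_nonneg, h0]
  exact bgProvisoΛ_UbgMSOfRecord_of_thm1Scaled h15 S hι hS hpos ν M K k cR hnum ha₀ hα hBα
    (hloc_of_thm1Scaled_axial' h15 S hι h𝓜 ν M K k cR hB₃ hnum ha₀ hBα' (fun n hn1 hnk => (hα n hn1 hnk).1)
      (fun j hj1 hjk => hsN (j + 1) (by omega) (by omega)) hcB hsmallI hcubeΩ h3I)
    (h238_of_thm1Scaled_axial' h15 S hι h𝓜 ν M K k cR hB₃ hnum ha₀ hBα' (fun n hn1 hnk => (hα n hn1 hnk).1)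
      (fun n hn1 hnk => hsN n hn1 (by omega)) hBCM hsmallMS h3MS)

/-- **v1.1 — ★★ THE RANGED ROW with the cube geometry discharged AND chart reachability through the class bounds** (the form node00-def-K0a's `A0OfThm1`
re-pin can meet at every scale of the window: `(d−1)·L·M·η_j·(B₃·cR·ε_j) ≤ ½`, `(d−1)·M·η_n·(B₃·cR·ε_n) ≤ ½`): from the named fact
`VariationalThm1Scaled B₃ a₀ a₁`, the numerics (FILE 2 + FILE 4), the arithmetic side conditions (C1) `R_j = L·t_j`, (C2) `L^jMR_j ∣ 2L^{m+K}` at the scales `1 ≤ j ≤ k` along the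
setting's history, no wrapping of the cubes of record, and the two DERIVATIVE members (1.12)(c)∕(2.38)(c) for the axial potentials — nothing else displayed.
[cite: Balaban1988Convergent, (2.27)–(2.28) p.259, (2.34)–(2.41) p.261, p.256–257; Balaban1985Variational, Thm 1 (8)–(10) p.279; Balaban1987RG1, (1.11)–(1.16) p.262] -/
theorem bgProvisoΛ_UbgMSOfRecord_of_thm1Scaled_compatible' {B₃ a₀ a₁ : ℝ} (h15 : VariationalThm1Scaled F N B₃ a₀ a₁)
    (S : Sect2.Setting (MatA N) (SU N)) (hι : S.ι = ιSU N) (h𝓜 : S.𝓜 = B12RegularSpaces111SpecialUnitary.suModel N) (hS : S.Laws) (hpos : S.Pos)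
    (ν : Stage7Numerics) {M : ℕ} (hM : 0 < M) (K k : ℕ) (cR : ℝ) (hB₃ : 0 ≤ B₃)
    (hnum : ∀ n, n ≤ k → 0 < cR * epsOfRecord ν S.flow.g n ∧ cR * epsOfRecord ν S.flow.g n ≤ a₁ ∧ B₃ * (cR * epsOfRecord ν S.flow.g n) ≤ ν.εreg)
    (ha₀ : ν.εreg ≤ a₀)
    (hα : ∀ n, 1 ≤ n → n ≤ k → 0 < S.lf.alpha0 (S.flow.g n) ∧ 0 < S.lf.alpha1 (S.flow.g n))
    (hBα : ∀ n, 1 ≤ n → n ≤ k → B₃ * (cR * epsOfRecord ν S.flow.g n) ≤ (1 - S.βc) * S.lf.alpha0 (S.flow.g n))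
    (hsN : ∀ n, 1 ≤ n → n ≤ k + 1 → ((B14.Eq213MaximalDomains.side (F.P K).L M n : ℕ) : ℤ) < (F.P K).sitesPerDir 0)
    (hcB : 2 * (((F.P K).d - 1 : ℕ) : ℝ) * ((F.P K).L * M) < S.cB) (hBCM : 2 * (((F.P K).d - 1 : ℕ) : ℝ) * M < S.B * S.C * S.Mr)
    (hsmallI : ∀ j, 1 ≤ j → j ≤ k → (((F.P K).d - 1 : ℕ) : ℝ) * ((F.P K).L * M) * (F.P K).eta j * (B₃ * (cR * epsOfRecord ν S.flow.g j)) ≤ 1 / 2)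
    (hsmallMS : ∀ n, 1 ≤ n → n ≤ k → (((F.P K).d - 1 : ℕ) : ℝ) * M * (F.P K).eta n * (B₃ * (cR * epsOfRecord ν S.flow.g n)) ≤ 1 / 2)
    (hC1 : ∀ j, 1 ≤ j → j ≤ k → ∃ t : ℕ, 0 < t ∧ RkOfRecord (F.P K).L ν.r (S.flow.g j) = (F.P K).L * t)
    (hC2 : ∀ j, 1 ≤ j → j ≤ k → dCubeSide (F.P K).L M (RkOfRecord (F.P K).L ν.r (S.flow.g j)) j ∣ (F.P K).sitesPerDir 0)
    (h3I : ∀ (s : SeqOfRecord F ν M S.flow.g K k) (W : MSField (F.P K) (SU N)), W ∈ regSuppOfRecord F N ν M S.flow.g K k cR s →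
      W ∈ solvableDom (avOfRecord F N K) (regMSOfRecord F N ν K k s.Ω) (genSet s.Ω k) →
      ∀ j, 1 ≤ j → j ≤ k → ∀ X : (Sect2.domSys (F.P K) M j).Dom, Sect2.domSites (F.P K) M j X ⊆ s.Λ j →
      ∀ a ∈ cubeIndices (F.P K) (B14.Eq213MaximalDomains.side (F.P K).L M (j + 1)),
        (cubeEnl (F.P K) (B14.Eq213MaximalDomains.side (F.P K).L M (j + 1)) a 0 ∩ Sect2.domSites (F.P K) M j X).Nonempty →
        ∀ q ∈ (Sect2.regionOfSet (F.P K) (cubeEnl (F.P K) (B14.Eq213MaximalDomains.side (F.P K).L M (j + 1)) a 0 ∩ Sect2.domSites (F.P K) M j X)).dpairs,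
          ‖grad ((F.P K).eta j) q.2.1 (fun y => axialPotential (UbgMSOfRecord F N ν M S.flow.g K k s W)
            (boxLo (B14.Eq213MaximalDomains.side (F.P K).L M (j + 1)) a) (boxHi (B14.Eq213MaximalDomains.side (F.P K).L M (j + 1)) a) ((F.P K).eta j)
            ⟨y, q.2.2⟩) q.1‖ < S.cB * S.lf.alpha0 (S.flow.g j))
    (h3MS : ∀ (s : SeqOfRecord F ν M S.flow.g K k) (W : MSField (F.P K) (SU N)), W ∈ regSuppOfRecord F N ν M S.flow.g K k cR s →
      W ∈ solvableDom (avOfRecord F N K) (regMSOfRecord F N ν K k s.Ω) (genSet s.Ω k) →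
      ∀ j, 1 ≤ j → j ≤ k → ∀ X : (Sect2.domSys (F.P K) M j).Dom, ∀ n, 1 ≤ n → n ≤ j →
      ∀ a ∈ cubeIndices (F.P K) (B14.Eq213MaximalDomains.side (F.P K).L M n),
        (cubeEnl (F.P K) (B14.Eq213MaximalDomains.side (F.P K).L M n) a 0 ∩ Sect2.domSites (F.P K) M j X).Nonempty →
        cubeEnl (F.P K) (B14.Eq213MaximalDomains.side (F.P K).L M n) a 0 ⊆ s.Ω n →
        ∀ q ∈ (Sect2.regionOfSet (F.P K) (cubeEnl (F.P K) (B14.Eq213MaximalDomains.side (F.P K).L M n) a 0 ∩ Sect2.domSites (F.P K) M j X)).dpairs,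
          (((F.P K).L : ℝ) ^ n * (F.P K).eta j) ^ 2 * ‖grad ((F.P K).eta j) q.2.1 (fun y => axialPotential (UbgMSOfRecord F N ν M S.flow.g K k s W)
            (boxLo (B14.Eq213MaximalDomains.side (F.P K).L M n) a) (boxHi (B14.Eq213MaximalDomains.side (F.P K).L M n) a) ((F.P K).eta j) ⟨y, q.2.2⟩) q.1‖ <
            rad238 S.B S.C S.Mr (S.lf.alpha0 (S.flow.g n))) :
    BgProvisoΛ F N K S (Sect2.Residual.unit (F.P K) (MatA N)) M k (regSuppOfRecord F N ν M S.flow.g K k cR) (UbgMSOfRecord F N ν M S.flow.g K k) :=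
  bgProvisoΛ_UbgMSOfRecord_of_thm1Scaled_axial' h15 S hι h𝓜 hS hpos ν M K k cR hB₃ hnum ha₀ hα hBα hsN hcB hBCM hsmallI hsmallMS
    (fun s j h1 hjk X hX a ha hne => hcubeΩ_of_compatible ν hM S.flow.g K k s hC1 hC2 j h1 hjk X hX a ha hne) h3I h3MS

end V11

/-! ## §5 (v1.2, append-only)  PER-SEQUENCE assembly from CLASS BOUNDS, and the FAITHFUL chain: the row's body at every SEPARATED sequence from `VariationalThm1ScaledSep` -/

section Sep

variable {F : T4Family} {N : ℕ} [NeZero N]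

/-- **THE ROW'S BODY AT ONE SEQUENCE `s`, FROM PER-SCALE CLASS BOUNDS `b_n·η_n²` on def-R's background** (whatever their source) + numerics + the compatibility (C1)(C2) + no
wrapping + ONLY the derivative members of (1.12)∕(2.38) for the axial potentials: for every retained `𝐖`, scale `1 ≤ j ≤ k` and domain `X`, the two guarded memberships of
`BgProvisoΛ`.  The interface both named facts plug into (`VariationalThm1Scaled`: every `s`; `VariationalThm1ScaledSep`: separated `s`). [cite: Balaban1988Convergent, (2.27)–(2.28) p.259, (2.34)–(2.41) p.261; Balaban1987RG1, (1.11)–(1.16) p.262] -/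
theorem bgRowAt_of_classBounds (S : Sect2.Setting (MatA N) (SU N)) (hι : S.ι = ιSU N) (h𝓜 : S.𝓜 = B12RegularSpaces111SpecialUnitary.suModel N) (hS : S.Laws)
    (hpos : S.Pos) (ν : Stage7Numerics) {M : ℕ} (hM : 0 < M) (K k : ℕ) (cR : ℝ) {b : ℕ → ℝ} (hb0 : ∀ n, n ≤ k → 0 ≤ b n)
    (s : SeqOfRecord F ν M S.flow.g K k)
    (hclass : ∀ W : MSField (F.P K) (SU N), W ∈ regSuppOfRecord F N ν M S.flow.g K k cR s →
      W ∈ solvableDom (avOfRecord F N K) (regMSOfRecord F N ν K k s.Ω) (genSet s.Ω k) →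
      ∀ n, n ≤ k → PlaqSmallOn (omegaPlaqs s.Ω n) (b n * (F.P K).eta n ^ 2) (UbgMSOfRecord F N ν M S.flow.g K k s W))
    (hα : ∀ n, 1 ≤ n → n ≤ k → 0 < S.lf.alpha0 (S.flow.g n) ∧ 0 < S.lf.alpha1 (S.flow.g n))
    (hbα : ∀ n, 1 ≤ n → n ≤ k → b n ≤ (1 - S.βc) * S.lf.alpha0 (S.flow.g n))
    (hsN : ∀ n, 1 ≤ n → n ≤ k + 1 → ((B14.Eq213MaximalDomains.side (F.P K).L M n : ℕ) : ℤ) < (F.P K).sitesPerDir 0)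
    (hcB : 2 * (((F.P K).d - 1 : ℕ) : ℝ) * ((F.P K).L * M) < S.cB) (hBCM : 2 * (((F.P K).d - 1 : ℕ) : ℝ) * M < S.B * S.C * S.Mr)
    (hsmallI : ∀ j, 1 ≤ j → j ≤ k → (((F.P K).d - 1 : ℕ) : ℝ) * ((F.P K).L * M) * (F.P K).eta j * b j ≤ 1 / 2)
    (hsmallMS : ∀ n, 1 ≤ n → n ≤ k → (((F.P K).d - 1 : ℕ) : ℝ) * M * (F.P K).eta n * b n ≤ 1 / 2)
    (hC1 : ∀ j, 1 ≤ j → j ≤ k → ∃ t : ℕ, 0 < t ∧ RkOfRecord (F.P K).L ν.r (S.flow.g j) = (F.P K).L * t)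
    (hC2 : ∀ j, 1 ≤ j → j ≤ k → dCubeSide (F.P K).L M (RkOfRecord (F.P K).L ν.r (S.flow.g j)) j ∣ (F.P K).sitesPerDir 0)
    (h3I : ∀ W : MSField (F.P K) (SU N), W ∈ regSuppOfRecord F N ν M S.flow.g K k cR s →
      W ∈ solvableDom (avOfRecord F N K) (regMSOfRecord F N ν K k s.Ω) (genSet s.Ω k) →
      ∀ j, 1 ≤ j → j ≤ k → ∀ X : (Sect2.domSys (F.P K) M j).Dom, Sect2.domSites (F.P K) M j X ⊆ s.Λ j →
      ∀ a ∈ cubeIndices (F.P K) (B14.Eq213MaximalDomains.side (F.P K).L M (j + 1)),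
        (cubeEnl (F.P K) (B14.Eq213MaximalDomains.side (F.P K).L M (j + 1)) a 0 ∩ Sect2.domSites (F.P K) M j X).Nonempty →
        ∀ q ∈ (Sect2.regionOfSet (F.P K) (cubeEnl (F.P K) (B14.Eq213MaximalDomains.side (F.P K).L M (j + 1)) a 0 ∩ Sect2.domSites (F.P K) M j X)).dpairs,
          ‖grad ((F.P K).eta j) q.2.1 (fun y => axialPotential (UbgMSOfRecord F N ν M S.flow.g K k s W)
            (boxLo (B14.Eq213MaximalDomains.side (F.P K).L M (j + 1)) a) (boxHi (B14.Eq213MaximalDomains.side (F.P K).L M (j + 1)) a) ((F.P K).eta j)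
            ⟨y, q.2.2⟩) q.1‖ < S.cB * S.lf.alpha0 (S.flow.g j))
    (h3MS : ∀ W : MSField (F.P K) (SU N), W ∈ regSuppOfRecord F N ν M S.flow.g K k cR s →
      W ∈ solvableDom (avOfRecord F N K) (regMSOfRecord F N ν K k s.Ω) (genSet s.Ω k) →
      ∀ j, 1 ≤ j → j ≤ k → ∀ X : (Sect2.domSys (F.P K) M j).Dom, ∀ n, 1 ≤ n → n ≤ j →
      ∀ a ∈ cubeIndices (F.P K) (B14.Eq213MaximalDomains.side (F.P K).L M n),
        (cubeEnl (F.P K) (B14.Eq213MaximalDomains.side (F.P K).L M n) a 0 ∩ Sect2.domSites (F.P K) M j X).Nonempty →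
        cubeEnl (F.P K) (B14.Eq213MaximalDomains.side (F.P K).L M n) a 0 ⊆ s.Ω n →
        ∀ q ∈ (Sect2.regionOfSet (F.P K) (cubeEnl (F.P K) (B14.Eq213MaximalDomains.side (F.P K).L M n) a 0 ∩ Sect2.domSites (F.P K) M j X)).dpairs,
          (((F.P K).L : ℝ) ^ n * (F.P K).eta j) ^ 2 * ‖grad ((F.P K).eta j) q.2.1 (fun y => axialPotential (UbgMSOfRecord F N ν M S.flow.g K k s W)
            (boxLo (B14.Eq213MaximalDomains.side (F.P K).L M n) a) (boxHi (B14.Eq213MaximalDomains.side (F.P K).L M n) a) ((F.P K).eta j) ⟨y, q.2.2⟩) q.1‖ <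
            rad238 S.B S.C S.Mr (S.lf.alpha0 (S.flow.g n))) :
    ∀ W : MSField (F.P K) (SU N), W ∈ regSuppOfRecord F N ν M S.flow.g K k cR s → ∀ j, 1 ≤ j → j ≤ k → ∀ X : (Sect2.domSys (F.P K) M j).Dom,
      (Sect2.domSites (F.P K) M j X ⊆ s.Λ j →
        Sect2.ofBackgroundC S.ι (UbgMSOfRecord F N ν M S.flow.g K k s W) ∈
          Sect2.spaceI S (Sect2.Residual.unit (F.P K) (MatA N)) M j (Sect2.domSites (F.P K) M j X) (S.lf.alpha0 (S.flow.g j)) (S.lf.alpha1 (S.flow.g j))) ∧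
      (Sect2.admB (F.P K) ν M S.flow.g s.Ω s.Λ j (Sect2.domSites (F.P K) M j X) = true →
        Sect2.ofBackgroundC S.ι (UbgMSOfRecord F N ν M S.flow.g K k s W) ∈
          Sect2.spaceMS S (Sect2.Residual.unit (F.P K) (MatA N)) M j (Sect2.domSites (F.P K) M j X) s.Ω) := by
  intro W hW j h1 hjk X
  have hd : (0 : ℝ) ≤ (((F.P K).d - 1 : ℕ) : ℝ) := Nat.cast_nonneg _
  have hηj : 0 < (F.P K).eta j := pow_pos (inv_pos.mpr (Nat.cast_pos.mpr (F.P K).L_pos)) j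
  have hbα' : ∀ n, 1 ≤ n → n ≤ k → b n ≤ S.lf.alpha0 (S.flow.g n) := by
    intro n hn1 hnk
    refine (hbα n hn1 hnk).trans ?_
    have h0 := (hα n hn1 hnk).1.le
    nlinarith [hpos.βc_nonneg, h0]
  refine ⟨fun hX => ?_, fun _ => ?_⟩
  · -- the `U^c_j` conjunct: class bound at scale `j`, (1.12)(a)(b) by the axial gauge on the cubes of `X`, (c) displayed
    have hcubeΩ := hcubeΩ_of_compatible (F := F) ν hM S.flow.g K k s hC1 hC2 j h1 hjk X hX
    have hloc : W ∈ solvableDom (avOfRecord F N K) (regMSOfRecord F N ν K k s.Ω) (genSet s.Ω k) →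
        ∀ C ∈ Sect2.cubesI M j (Sect2.domSites (F.P K) M j X), ∃ u : Site (F.P K) 0 → (MatA N)ˣ, (∀ x, u x ∈ S.𝓜.G) ∧ ∃ A : PBond (F.P K) 0 → MatA N,
          (∀ bd ∈ C.bonds, gaugeU u (fun b' => S.ι (UbgMSOfRecord F N ν M S.flow.g K k s W b')) bd = expI ((F.P K).eta j) (A bd)) ∧
          (∀ bd ∈ C.bonds, ‖A bd‖ < S.cB * S.lf.alpha0 (S.flow.g j)) ∧
          ∀ q ∈ C.dpairs, ‖grad ((F.P K).eta j) q.2.1 (fun y => A ⟨y, q.2.2⟩) q.1‖ < S.cB * S.lf.alpha0 (S.flow.g j) := by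
      intro hsol
      have hclassj : PlaqSmallOn (B8Eq17ClassAkV1.plaqsOf (s.Ω j)) (b j * (F.P K).eta j ^ 2) (UbgMSOfRecord F N ν M S.flow.g K k s W) := by
        have h := hclass W hW hsol j hjk
        rwa [omegaPlaqs_of_ne_zero _ (Nat.one_le_iff_ne_zero.mp h1)] at h
      have hside := side_pred_mul_eta_le (P := F.P K) M j
      have hα0 : 0 < S.lf.alpha0 (S.flow.g j) := (hα j h1 hjk).1
      have hs0 : (0 : ℝ) ≤ ((B14.Eq213MaximalDomains.side (F.P K).L M (j + 1) - 1 : ℕ) : ℝ) := Nat.cast_nonneg _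
      have hbj0 := hb0 j hjk
      have hsmall : (((F.P K).d - 1 : ℕ) : ℝ) * ((B14.Eq213MaximalDomains.side (F.P K).L M (j + 1) - 1 : ℕ) : ℝ) * (b j * (F.P K).eta j ^ 2) ≤ 1 / 2 := by
        calc (((F.P K).d - 1 : ℕ) : ℝ) * ((B14.Eq213MaximalDomains.side (F.P K).L M (j + 1) - 1 : ℕ) : ℝ) * (b j * (F.P K).eta j ^ 2)
            = (((F.P K).d - 1 : ℕ) : ℝ) * ((((B14.Eq213MaximalDomains.side (F.P K).L M (j + 1) - 1 : ℕ) : ℝ)) * (F.P K).eta j) * (F.P K).eta j * b j := by ring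
          _ ≤ (((F.P K).d - 1 : ℕ) : ℝ) * ((F.P K).L * M) * (F.P K).eta j * b j := by gcongr
          _ ≤ 1 / 2 := hsmallI j h1 hjk
      have hcB' : 2 * ((((F.P K).d - 1 : ℕ) : ℝ) * ((B14.Eq213MaximalDomains.side (F.P K).L M (j + 1) - 1 : ℕ) : ℝ) * (b j * (F.P K).eta j ^ 2)) / (F.P K).eta j <
          S.cB * S.lf.alpha0 (S.flow.g j) := by
        rw [div_lt_iff₀ hηj]
        have hbα := hbα' j h1 hjk
        calc 2 * ((((F.P K).d - 1 : ℕ) : ℝ) * ((B14.Eq213MaximalDomains.side (F.P K).L M (j + 1) - 1 : ℕ) : ℝ) * (b j * (F.P K).eta j ^ 2))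
            = (2 * (((F.P K).d - 1 : ℕ) : ℝ) * ((((B14.Eq213MaximalDomains.side (F.P K).L M (j + 1) - 1 : ℕ) : ℝ)) * (F.P K).eta j) * b j) * (F.P K).eta j := by ring
          _ ≤ (2 * (((F.P K).d - 1 : ℕ) : ℝ) * ((F.P K).L * M) * S.lf.alpha0 (S.flow.g j)) * (F.P K).eta j := by gcongr
          _ < S.cB * S.lf.alpha0 (S.flow.g j) * (F.P K).eta j := by
            have := mul_lt_mul_of_pos_right hcB hα0
            nlinarith
      simp only [hι, h𝓜]
      exact localGauge_cubesI_of_classBound (hsN (j + 1) (by omega) (by omega)) hcubeΩ hbj0 hclassj hsmall hcB' (h3I W hW hsol j h1 hjk X hX)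
    exact ofBackgroundC_UbgMSOfRecord_mem_spaceI_of_classBound S hι hS hpos.cB_pos ν M S.flow.g K k s W h1 hjk (hα j h1 hjk).1 (hα j h1 hjk).2 X hX
      (hbα' j h1 hjk) (fun hsol => hclass W hW hsol j hjk) hloc
  · -- the `Ũ^c_j` conjunct: class bounds at the scales `≤ j`, (2.34) plaquettes, (2.38)(a)(b) by the axial gauge on the layer cubes, (c) displayed
    have h238 : W ∈ solvableDom (avOfRecord F N K) (regMSOfRecord F N ν K k s.Ω) (genSet s.Ω k) →
        CondII238 S.𝓜 (Sect2.frameMS (Sect2.Residual.unit (F.P K) (MatA N)) M j (Sect2.domSites (F.P K) M j X) s.Ω)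
          (MSConsts.ofParams (F.P K) S.βc S.B S.C S.Mr j) (fun n => S.lf.alpha0 (S.flow.g n)) (fun b' => S.ι (UbgMSOfRecord F N ν M S.flow.g K k s W b')) := by
      intro hsol
      have hclassn : ∀ n, 1 ≤ n → n ≤ j →
          PlaqSmallOn (B8Eq17ClassAkV1.plaqsOf (s.Ω n)) (b n * (F.P K).eta n ^ 2) (UbgMSOfRecord F N ν M S.flow.g K k s W) := by
        intro n hn1 hnj
        have h := hclass W hW hsol n (hnj.trans hjk)
        rwa [omegaPlaqs_of_ne_zero _ (Nat.one_le_iff_ne_zero.mp hn1)] at h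
      have key : ∀ n, 1 ≤ n → n ≤ j →
          (((F.P K).d - 1 : ℕ) : ℝ) * ((B14.Eq213MaximalDomains.side (F.P K).L M n - 1 : ℕ) : ℝ) * (b n * (F.P K).eta n ^ 2) ≤
            (((F.P K).d - 1 : ℕ) : ℝ) * M * (F.P K).eta n * b n := by
        intro n hn1 hnj
        have hside := side_pred_mul_eta_le' (P := F.P K) M n
        have hηn : 0 ≤ (F.P K).eta n := (pow_pos (inv_pos.mpr (Nat.cast_pos.mpr (F.P K).L_pos)) n).le
        have hbn0 := hb0 n (hnj.trans hjk)
        calc (((F.P K).d - 1 : ℕ) : ℝ) * ((B14.Eq213MaximalDomains.side (F.P K).L M n - 1 : ℕ) : ℝ) * (b n * (F.P K).eta n ^ 2)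
            = (((F.P K).d - 1 : ℕ) : ℝ) * (((B14.Eq213MaximalDomains.side (F.P K).L M n - 1 : ℕ) : ℝ) * (F.P K).eta n) * (F.P K).eta n * b n := by ring
          _ ≤ (((F.P K).d - 1 : ℕ) : ℝ) * M * (F.P K).eta n * b n := by gcongr
      simp only [hι, h𝓜]
      refine condII238_cubesMS_of_classBounds (fun n hn1 hnj => hsN n hn1 (by omega)) (fun n _ hnj => hb0 n (hnj.trans hjk)) hclassn
        (fun n hn1 hnj => (key n hn1 hnj).trans (hsmallMS n hn1 (hnj.trans hjk))) (fun n hn1 hnj => ?_)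
        (fun n hn1 hnj a ha hne hΩ q hq => h3MS W hW hsol j h1 hjk X n hn1 hnj a ha hne hΩ q hq)
      have hα0 := (hα n hn1 (hnj.trans hjk)).1
      have hside := side_pred_mul_eta_le' (P := F.P K) M n
      have hbn0 := hb0 n (hnj.trans hjk)
      have hbα := hbα' n hn1 (hnj.trans hjk)
      have hLη := L_pow_mul_eta (P := F.P K) n
      rw [mul_div_assoc', div_lt_iff₀ hηj]
      unfold rad238
      calc ((F.P K).L : ℝ) ^ n * (F.P K).eta j * (2 * ((((F.P K).d - 1 : ℕ) : ℝ) * ((B14.Eq213MaximalDomains.side (F.P K).L M n - 1 : ℕ) : ℝ) * (b n * (F.P K).eta n ^ 2)))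
          = (2 * (((F.P K).d - 1 : ℕ) : ℝ) * (((B14.Eq213MaximalDomains.side (F.P K).L M n - 1 : ℕ) : ℝ) * (F.P K).eta n) *
              (((F.P K).L : ℝ) ^ n * (F.P K).eta n) * b n) * (F.P K).eta j := by ring
        _ ≤ (2 * (((F.P K).d - 1 : ℕ) : ℝ) * M * 1 * S.lf.alpha0 (S.flow.g n)) * (F.P K).eta j := by rw [hLη]; gcongr
        _ < S.B * S.C * S.Mr * S.lf.alpha0 (S.flow.g n) * (F.P K).eta j := by
            have := mul_lt_mul_of_pos_right hBCM hα0
            nlinarith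
    exact ofBackgroundC_UbgMSOfRecord_mem_spaceMS_of_classBound S hι hS hpos ν M K k s W (fun n hn1 hnj => hα n hn1 (hnj.trans hjk)) X
      (fun n hn1 hnj => hbα n hn1 (hnj.trans hjk)) (fun hsol n hn1 hnj => hclass W hW hsol n (hnj.trans hjk)) h238

/-- **★★★ THE FAITHFUL CHAIN — the row's body AT EVERY SEPARATED SEQUENCE with comparable thresholds, from `VariationalThm1ScaledSep`** ([15] Thm 1 (8) in the per-scale reading
for PRINT'S sequences): for `s` with `Sect2.SeqSeparated ν.M₁ s` and `cR·ε_n ≤ 2·cR·ε_{n+1}` along the history, every retained `𝐖`, scale `1 ≤ j ≤ k`, domain `X`: the two guarded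
memberships of `BgProvisoΛ` — from the named fact, the numerics (FILE 2's + the gauge half's, class-bound form), (C1)(C2), no wrapping, and the two derivative members.  This is the
supplier of a separation-GUARDED token (`Sect2.SeqSeparated θ.ν.M₁ s →` in front of `BgProvisoΛ`'s body); for the unguarded token use FILE 4∕5's `…_compatible'` with
`VariationalThm1Scaled`. [cite: Balaban1985Variational, Thm 1 (8)–(10) p.279; Balaban1985RegularSpaces, (1.3)–(1.8) p.77; Balaban1988Convergent, (2.7)–(2.8) pp.255–256, (2.27)–(2.28) p.259, (2.34)–(2.41) p.261] -/
theorem bgRowAt_of_thm1ScaledSep {B₃ a₀ a₁ : ℝ} (h15 : VariationalThm1ScaledSep F N B₃ a₀ a₁)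
    (S : Sect2.Setting (MatA N) (SU N)) (hι : S.ι = ιSU N) (h𝓜 : S.𝓜 = B12RegularSpaces111SpecialUnitary.suModel N) (hS : S.Laws) (hpos : S.Pos)
    (ν : Stage7Numerics) {M : ℕ} (hM : 0 < M) (K k : ℕ) (cR : ℝ) (hB₃ : 0 ≤ B₃)
    (hnum : ∀ n, n ≤ k → 0 < cR * epsOfRecord ν S.flow.g n ∧ cR * epsOfRecord ν S.flow.g n ≤ a₁ ∧ B₃ * (cR * epsOfRecord ν S.flow.g n) ≤ ν.εreg)
    (ha₀ : ν.εreg ≤ a₀) (hcomp : ∀ n, n < k → cR * epsOfRecord ν S.flow.g n ≤ 2 * (cR * epsOfRecord ν S.flow.g (n + 1)))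
    (hα : ∀ n, 1 ≤ n → n ≤ k → 0 < S.lf.alpha0 (S.flow.g n) ∧ 0 < S.lf.alpha1 (S.flow.g n))
    (hBα : ∀ n, 1 ≤ n → n ≤ k → B₃ * (cR * epsOfRecord ν S.flow.g n) ≤ (1 - S.βc) * S.lf.alpha0 (S.flow.g n))
    (hsN : ∀ n, 1 ≤ n → n ≤ k + 1 → ((B14.Eq213MaximalDomains.side (F.P K).L M n : ℕ) : ℤ) < (F.P K).sitesPerDir 0)
    (hcB : 2 * (((F.P K).d - 1 : ℕ) : ℝ) * ((F.P K).L * M) < S.cB) (hBCM : 2 * (((F.P K).d - 1 : ℕ) : ℝ) * M < S.B * S.C * S.Mr)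
    (hsmallI : ∀ j, 1 ≤ j → j ≤ k → (((F.P K).d - 1 : ℕ) : ℝ) * ((F.P K).L * M) * (F.P K).eta j * (B₃ * (cR * epsOfRecord ν S.flow.g j)) ≤ 1 / 2)
    (hsmallMS : ∀ n, 1 ≤ n → n ≤ k → (((F.P K).d - 1 : ℕ) : ℝ) * M * (F.P K).eta n * (B₃ * (cR * epsOfRecord ν S.flow.g n)) ≤ 1 / 2)
    (hC1 : ∀ j, 1 ≤ j → j ≤ k → ∃ t : ℕ, 0 < t ∧ RkOfRecord (F.P K).L ν.r (S.flow.g j) = (F.P K).L * t)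
    (hC2 : ∀ j, 1 ≤ j → j ≤ k → dCubeSide (F.P K).L M (RkOfRecord (F.P K).L ν.r (S.flow.g j)) j ∣ (F.P K).sitesPerDir 0)
    (s : SeqOfRecord F ν M S.flow.g K k) (hsep : Sect2.SeqSeparated ν.M₁ s)
    (h3I : ∀ W : MSField (F.P K) (SU N), W ∈ regSuppOfRecord F N ν M S.flow.g K k cR s →
      W ∈ solvableDom (avOfRecord F N K) (regMSOfRecord F N ν K k s.Ω) (genSet s.Ω k) →
      ∀ j, 1 ≤ j → j ≤ k → ∀ X : (Sect2.domSys (F.P K) M j).Dom, Sect2.domSites (F.P K) M j X ⊆ s.Λ j →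
      ∀ a ∈ cubeIndices (F.P K) (B14.Eq213MaximalDomains.side (F.P K).L M (j + 1)),
        (cubeEnl (F.P K) (B14.Eq213MaximalDomains.side (F.P K).L M (j + 1)) a 0 ∩ Sect2.domSites (F.P K) M j X).Nonempty →
        ∀ q ∈ (Sect2.regionOfSet (F.P K) (cubeEnl (F.P K) (B14.Eq213MaximalDomains.side (F.P K).L M (j + 1)) a 0 ∩ Sect2.domSites (F.P K) M j X)).dpairs,
          ‖grad ((F.P K).eta j) q.2.1 (fun y => axialPotential (UbgMSOfRecord F N ν M S.flow.g K k s W)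
            (boxLo (B14.Eq213MaximalDomains.side (F.P K).L M (j + 1)) a) (boxHi (B14.Eq213MaximalDomains.side (F.P K).L M (j + 1)) a) ((F.P K).eta j)
            ⟨y, q.2.2⟩) q.1‖ < S.cB * S.lf.alpha0 (S.flow.g j))
    (h3MS : ∀ W : MSField (F.P K) (SU N), W ∈ regSuppOfRecord F N ν M S.flow.g K k cR s →
      W ∈ solvableDom (avOfRecord F N K) (regMSOfRecord F N ν K k s.Ω) (genSet s.Ω k) →
      ∀ j, 1 ≤ j → j ≤ k → ∀ X : (Sect2.domSys (F.P K) M j).Dom, ∀ n, 1 ≤ n → n ≤ j →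
      ∀ a ∈ cubeIndices (F.P K) (B14.Eq213MaximalDomains.side (F.P K).L M n),
        (cubeEnl (F.P K) (B14.Eq213MaximalDomains.side (F.P K).L M n) a 0 ∩ Sect2.domSites (F.P K) M j X).Nonempty →
        cubeEnl (F.P K) (B14.Eq213MaximalDomains.side (F.P K).L M n) a 0 ⊆ s.Ω n →
        ∀ q ∈ (Sect2.regionOfSet (F.P K) (cubeEnl (F.P K) (B14.Eq213MaximalDomains.side (F.P K).L M n) a 0 ∩ Sect2.domSites (F.P K) M j X)).dpairs,
          (((F.P K).L : ℝ) ^ n * (F.P K).eta j) ^ 2 * ‖grad ((F.P K).eta j) q.2.1 (fun y => axialPotential (UbgMSOfRecord F N ν M S.flow.g K k s W)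
            (boxLo (B14.Eq213MaximalDomains.side (F.P K).L M n) a) (boxHi (B14.Eq213MaximalDomains.side (F.P K).L M n) a) ((F.P K).eta j) ⟨y, q.2.2⟩) q.1‖ <
            rad238 S.B S.C S.Mr (S.lf.alpha0 (S.flow.g n))) :
    ∀ W : MSField (F.P K) (SU N), W ∈ regSuppOfRecord F N ν M S.flow.g K k cR s → ∀ j, 1 ≤ j → j ≤ k → ∀ X : (Sect2.domSys (F.P K) M j).Dom,
      (Sect2.domSites (F.P K) M j X ⊆ s.Λ j →
        Sect2.ofBackgroundC S.ι (UbgMSOfRecord F N ν M S.flow.g K k s W) ∈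
          Sect2.spaceI S (Sect2.Residual.unit (F.P K) (MatA N)) M j (Sect2.domSites (F.P K) M j X) (S.lf.alpha0 (S.flow.g j)) (S.lf.alpha1 (S.flow.g j))) ∧
      (Sect2.admB (F.P K) ν M S.flow.g s.Ω s.Λ j (Sect2.domSites (F.P K) M j X) = true →
        Sect2.ofBackgroundC S.ι (UbgMSOfRecord F N ν M S.flow.g K k s W) ∈
          Sect2.spaceMS S (Sect2.Residual.unit (F.P K) (MatA N)) M j (Sect2.domSites (F.P K) M j X) s.Ω) :=
  bgRowAt_of_classBounds S hι h𝓜 hS hpos ν hM K k cR (fun n hn => mul_nonneg hB₃ (hnum n hn).1.le) s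
    (fun _ hW hsol => plaqSmallOn_UbgMSOfRecord_of_thm1ScaledSep h15 ν M S.flow.g K k cR s hsep hnum ha₀ hcomp hW hsol)
    hα hBα hsN hcB hBCM hsmallI hsmallMS hC1 hC2 h3I h3MS

end Sep

end Literature.MathematicalPhysics.QuantumFieldTheory.Balaban1983to89.Node00

end
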